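import Summits.RiemannHypothesis.RiemannHypothesis.Theorems.PfPersistenceF1PoissonTest

/-!
# PF persistence, fake seat 1 — the one-frequency weighted Paley–Wiener structure function (FAKES §1.15)

Unit `pub-rhpf-fake-1` of the `pub-rhpf` cell (mechanism / rigidity campaign; **no RH claims**).

FAKES §1.15 (THEOREM PW1, PROVED-informal, unconditional): for `0 < ℓ < L < 2ℓ`, `0 ≤ ε < 1`, the
weighted Paley–Wiener space `(PW_{L/2}, ∫ |F|² (1 - ε cos(ℓu + θ)) du)` is the de Branges space `H(E)` of
the EXPLICIT structure function `E(z) = (1 - ε²/4)^{-1/2} e^{-iLz/2} (1 + (ε/2) e^{i(ℓz+θ)})`; `|E|` is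
`2π/ℓ`-periodic on `ℝ` (flat gauge) and the round member `|E(u)|⁻² du` has the Poisson profile
`(1 - ε²/4)/(1 + ε cos(ℓu+θ) + ε²/4) = 1 - ε cos(ℓu+θ) + (ε²/2) cos 2(ℓu+θ) - …`, i.e. out-of-band
harmonics `kℓ` (`k ≥ 2`) of relative amplitude `2(ε/2)^k`.  In the one-prime regime `2 < U ≤ 3` of the
campaign this is the local model of `H_L` (explicit formula, §1.14 rider (e)), and it drives THEOREM-informal
F1-V.4: the round member fails the almost-periodicity test by the transient `(log²2/8) cos(t log 4)/log(t/2π)`.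

Typed and PROVED here (elementary, sorry-free): the factor `h(z) = 1 + r e^{i(ℓz+θ)}` and
`E₀(z) = e^{-i(L/2)z} h(z)` (`r = ε/2`; the positive normalising constant is omitted), the modulus identity
`|E₀(x+iy)|² = e^{Ly} (1 + 2 r e^{-ℓy} cos(ℓx+θ) + r² e^{-2ℓy})`, the HERMITE–BIEHLER inequality
`|E₀(x-iy)| < |E₀(x+iy)|` for `y > 0` whenever `0 < ℓ < L`, `0 ≤ r < 1` (through the real inequality
`1 + 2rcp + r²p² < s² (1 + 2rc/p + r²/p²)` for `1 < p < s`, `|c| ≤ 1`), the absence of real zeros, and the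
pointwise second-order identity behind the Poisson profile, and the FULL Poisson profile as a convergent
series `(1 - r²)/(1 + 2r cos ψ + r²) = 1 + Σ_{k≥1} 2(-r)^k cos kψ` (every harmonic present).  Nothing about
`ζ` is asserted.
-/

set_option linter.dupNamespace false

noncomputable section

open Complex

namespace Summit.RiemannHypothesis.RiemannHypothesis.Theorems.PfPersistence.Fake1.PWOneFreq

/-- The zero-free factor `h(z) = 1 + r e^{i(ℓ z + θ)}`. [FAKES §1.15 THEOREM PW1] -/
def hFac (ℓ r θ : ℝ) (z : ℂ) : ℂ :=
  1 + (r : ℂ) * Complex.exp (Complex.I * ((ℓ : ℂ) * z + θ))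

/-- The (un-normalised) structure function `E₀(z) = e^{-i(L/2)z} h(z)`. [FAKES §1.15 THEOREM PW1] -/
def structFn (L ℓ r θ : ℝ) (z : ℂ) : ℂ :=
  Complex.exp (-(Complex.I * ((L / 2 : ℝ) : ℂ) * z)) * hFac ℓ r θ z

/-! ## The real core of the Hermite–Biehler inequality -/

/-- For `1 < p < s`, `0 ≤ r < 1`, `-1 ≤ c`: `1 + 2rcp + r²p² < s²(1 + 2rc/p + r²/p²)`.  The difference is
affine in `c` with non-negative slope, and at `c = -1` it factors as
`[s(p-r) - p(1-rp)] [s(p-r) + p(1-rp)] / p²` with both brackets positive. [elementary] -/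
theorem core_ineq {p s r c : ℝ} (hp : 1 < p) (hps : p < s) (hr0 : 0 ≤ r) (hr1 : r < 1)
    (hc2 : -1 ≤ c) :
    1 + 2 * r * c * p + r ^ 2 * p ^ 2 < s ^ 2 * (1 + 2 * r * c / p + r ^ 2 / p ^ 2) := by
  have hp0 : 0 < p := by linarith
  have hpne : p ≠ 0 := hp0.ne'
  rw [← sub_pos]
  have key : s ^ 2 * (1 + 2 * r * c / p + r ^ 2 / p ^ 2) - (1 + 2 * r * c * p + r ^ 2 * p ^ 2)
      = (s ^ 2 * (p ^ 2 + 2 * r * c * p + r ^ 2) - p ^ 2 * (1 + 2 * r * c * p + r ^ 2 * p ^ 2)) / p ^ 2 := by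
    field_simp
  rw [key]
  apply div_pos _ (by positivity)
  have h1 : s ^ 2 * (p ^ 2 + 2 * r * c * p + r ^ 2) - p ^ 2 * (1 + 2 * r * c * p + r ^ 2 * p ^ 2)
      = (s * (p - r) - p * (1 - r * p)) * (s * (p - r) + p * (1 - r * p))
        + 2 * r * p * (c + 1) * (s ^ 2 - p ^ 2) := by
    ring
  rw [h1]
  have hs2 : 0 ≤ s ^ 2 - p ^ 2 := by nlinarith
  have hslope : 0 ≤ 2 * r * p * (c + 1) * (s ^ 2 - p ^ 2) :=
    mul_nonneg (mul_nonneg (mul_nonneg (mul_nonneg (by norm_num) hr0) hp0.le) (by linarith)) hs2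
  have hpr : 0 < p - r := by linarith
  have hlt : p * (p - r) < s * (p - r) := mul_lt_mul_of_pos_right hps hpr
  have hA : 0 < s * (p - r) - p * (1 - r * p) := by
    have : 0 < p * (p - 1) * (1 + r) := by positivity
    nlinarith
  have hB : 0 < s * (p - r) + p * (1 - r * p) := by
    have : 0 < p * (p + 1) * (1 - r) := mul_pos (by positivity) (by linarith)
    nlinarith
  have := mul_pos hA hB
  linarith

/-! ## Modulus identities -/

/-- Real part of the phase `i(ℓz+θ)` at `z = x+iy`. [elementary] -/
theorem re_phase (ℓ θ x y : ℝ) :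
    (Complex.I * ((ℓ : ℂ) * ((x : ℂ) + (y : ℂ) * Complex.I) + θ)).re = -(ℓ * y) := by
  simp [Complex.mul_re, Complex.mul_im]

/-- Imaginary part of the phase `i(ℓz+θ)` at `z = x+iy`. [elementary] -/
theorem im_phase (ℓ θ x y : ℝ) :
    (Complex.I * ((ℓ : ℂ) * ((x : ℂ) + (y : ℂ) * Complex.I) + θ)).im = ℓ * x + θ := by
  simp [Complex.mul_re, Complex.mul_im]

/-- Real part of the carrier exponent `-i(L/2)z` at `z = x+iy`. [elementary] -/
theorem re_carrier (L x y : ℝ) :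
    (-(Complex.I * ((L / 2 : ℝ) : ℂ) * ((x : ℂ) + (y : ℂ) * Complex.I))).re = L / 2 * y := by
  simp [Complex.mul_re, Complex.mul_im]

/-- `|h(x+iy)|² = 1 + 2ρ cos(ℓx+θ) + ρ²` with `ρ = r e^{-ℓy}`. [FAKES §1.15 THEOREM PW1 (a)] -/
theorem normSq_hFac (ℓ r θ x y : ℝ) :
    Complex.normSq (hFac ℓ r θ ((x : ℂ) + (y : ℂ) * Complex.I))
      = 1 + 2 * (r * Real.exp (-(ℓ * y))) * Real.cos (ℓ * x + θ) + (r * Real.exp (-(ℓ * y))) ^ 2 := by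
  have hre := re_phase ℓ θ x y
  have him := im_phase ℓ θ x y
  rw [Complex.normSq_apply]
  simp only [hFac, Complex.add_re, Complex.one_re, Complex.mul_re, Complex.ofReal_re, Complex.ofReal_im,
    Complex.exp_re, Complex.exp_im, hre, him, Complex.add_im, Complex.one_im, Complex.mul_im, zero_mul,
    sub_zero, zero_add]
  have h := Real.sin_sq_add_cos_sq (ℓ * x + θ)
  linear_combination (r * Real.exp (-(ℓ * y))) ^ 2 * h

/-- `|E₀(x+iy)|² = e^{Ly}(1 + 2 r e^{-ℓy} cos(ℓx+θ) + r² e^{-2ℓy})`. [FAKES §1.15 THEOREM PW1 (a)] -/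
theorem normSq_structFn (L ℓ r θ x y : ℝ) :
    Complex.normSq (structFn L ℓ r θ ((x : ℂ) + (y : ℂ) * Complex.I))
      = Real.exp (L * y) *
        (1 + 2 * (r * Real.exp (-(ℓ * y))) * Real.cos (ℓ * x + θ) + (r * Real.exp (-(ℓ * y))) ^ 2) := by
  rw [structFn, map_mul, normSq_hFac, Complex.normSq_eq_norm_sq, Complex.norm_exp, re_carrier]
  congr 1
  rw [sq, ← Real.exp_add]
  congr 1
  ring

/-- On the real line: `|E₀(x)|² = 1 + 2r cos(ℓx+θ) + r²` (`= 1 + ε cos + ε²/4` for `r = ε/2`), a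
`2π/ℓ`-periodic function: `E₀` is the FLAT gauge. [FAKES §1.15 THEOREM PW1 (c)] -/
theorem normSq_structFn_real (L ℓ r θ x : ℝ) :
    Complex.normSq (structFn L ℓ r θ (x : ℂ)) = 1 + 2 * r * Real.cos (ℓ * x + θ) + r ^ 2 := by
  have h := normSq_structFn L ℓ r θ x 0
  simp only [Complex.ofReal_zero, zero_mul, add_zero, mul_zero, neg_zero, Real.exp_zero, mul_one,
    one_mul] at h
  rw [h]

/-- No real zeros when `0 ≤ r < 1`: `|E₀(x)|² ≥ (1 - r)² > 0`. [FAKES §1.15 THEOREM PW1 (a)] -/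
theorem structFn_ne_zero_real {r : ℝ} (hr0 : 0 ≤ r) (hr1 : r < 1) (L ℓ θ x : ℝ) :
    structFn L ℓ r θ (x : ℂ) ≠ 0 := by
  intro h
  have h0 : Complex.normSq (structFn L ℓ r θ (x : ℂ)) = 0 := by rw [h, map_zero]
  rw [normSq_structFn_real] at h0
  have hc : -1 ≤ Real.cos (ℓ * x + θ) := (abs_le.1 (Real.abs_cos_le_one _)).1
  nlinarith [mul_nonneg hr0 (by linarith : (0:ℝ) ≤ Real.cos (ℓ * x + θ) + 1)]

/-! ## The Hermite–Biehler inequality -/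

/-- **THEOREM PW1 (a), typed core.**  For `0 < ℓ < L`, `0 ≤ r < 1` and `y > 0`:
`|E₀(x - iy)|² < |E₀(x + iy)|²` — `E₀` is a Hermite–Biehler function (`|E₀^#| < |E₀|` on the upper
half-plane, since `E₀^#(z) = conj (E₀ (conj z))`). [FAKES §1.15 THEOREM PW1] -/
theorem hermiteBiehler_normSq {L ℓ r : ℝ} (hℓ : 0 < ℓ) (hℓL : ℓ < L) (hr0 : 0 ≤ r) (hr1 : r < 1)
    (θ x : ℝ) {y : ℝ} (hy : 0 < y) :
    Complex.normSq (structFn L ℓ r θ ((x : ℂ) + ((-y : ℝ) : ℂ) * Complex.I))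
      < Complex.normSq (structFn L ℓ r θ ((x : ℂ) + (y : ℂ) * Complex.I)) := by
  rw [normSq_structFn, normSq_structFn]
  have e1 : Real.exp (-(ℓ * -y)) = Real.exp (ℓ * y) := by congr 1; ring
  have e2 : Real.exp (L * -y) = (Real.exp (L * y))⁻¹ := by rw [← Real.exp_neg]; congr 1; ring
  have e3 : Real.exp (-(ℓ * y)) = (Real.exp (ℓ * y))⁻¹ := Real.exp_neg _
  rw [e1, e2, e3]
  have hp1 : 1 < Real.exp (ℓ * y) := by
    have h := Real.exp_lt_exp.2 (mul_pos hℓ hy)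
    rwa [Real.exp_zero] at h
  have hps : Real.exp (ℓ * y) < Real.exp (L * y) := Real.exp_lt_exp.2 (mul_lt_mul_of_pos_right hℓL hy)
  have hc := abs_le.1 (Real.abs_cos_le_one (ℓ * x + θ))
  have hp0 : 0 < Real.exp (ℓ * y) := Real.exp_pos _
  have hs0 : 0 < Real.exp (L * y) := Real.exp_pos _
  have core := core_ineq hp1 hps hr0 hr1 hc.1
  rw [← sub_pos]
  have key : Real.exp (L * y) * (1 + 2 * (r * (Real.exp (ℓ * y))⁻¹) * Real.cos (ℓ * x + θ)
        + (r * (Real.exp (ℓ * y))⁻¹) ^ 2)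
      - (Real.exp (L * y))⁻¹ * (1 + 2 * (r * Real.exp (ℓ * y)) * Real.cos (ℓ * x + θ)
        + (r * Real.exp (ℓ * y)) ^ 2)
      = (Real.exp (L * y) ^ 2 * (1 + 2 * r * Real.cos (ℓ * x + θ) / Real.exp (ℓ * y)
          + r ^ 2 / Real.exp (ℓ * y) ^ 2)
        - (1 + 2 * r * Real.cos (ℓ * x + θ) * Real.exp (ℓ * y) + r ^ 2 * Real.exp (ℓ * y) ^ 2))
        / Real.exp (L * y) := by
    field_simp
  rw [key]
  exact div_pos (sub_pos.2 core) hs0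

/-- The same in terms of norms: `‖E₀(x - iy)‖ < ‖E₀(x + iy)‖` for `y > 0`. [FAKES §1.15 THEOREM PW1 (a)] -/
theorem hermiteBiehler_norm {L ℓ r : ℝ} (hℓ : 0 < ℓ) (hℓL : ℓ < L) (hr0 : 0 ≤ r) (hr1 : r < 1)
    (θ x : ℝ) {y : ℝ} (hy : 0 < y) :
    ‖structFn L ℓ r θ ((x : ℂ) + ((-y : ℝ) : ℂ) * Complex.I)‖
      < ‖structFn L ℓ r θ ((x : ℂ) + (y : ℂ) * Complex.I)‖ := by
  have h := hermiteBiehler_normSq hℓ hℓL hr0 hr1 θ x hy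
  rw [Complex.normSq_eq_norm_sq, Complex.normSq_eq_norm_sq] at h
  exact lt_of_pow_lt_pow_left₀ 2 (norm_nonneg _) h

/-! ## The Poisson profile of the round member (pointwise identity) -/

/-- The round density `(1 - r²)/|E₀(x)|²` deviates from the in-band data `1 - 2r cos(ℓx+θ)` (`= 1 - ε cos`)
exactly by the second-order terms `(2r² cos 2(ℓx+θ) + 2r³ cos(ℓx+θ)) / |E₀(x)|²` — the beginning of the
Poisson tail `Σ_{k≥2} 2(-r)^k cos k(ℓx+θ)`, all of whose frequencies `kℓ ≥ 2ℓ > L` are OUT OF BAND.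
[FAKES §1.15 THEOREM PW1 (c)] -/
theorem roundDensity_sub_inBand {r : ℝ} (hr0 : 0 ≤ r) (hr1 : r < 1) (L ℓ θ x : ℝ) :
    (1 - r ^ 2) / Complex.normSq (structFn L ℓ r θ (x : ℂ)) - (1 - 2 * r * Real.cos (ℓ * x + θ))
      = (2 * r ^ 2 * Real.cos (2 * (ℓ * x + θ)) + 2 * r ^ 3 * Real.cos (ℓ * x + θ))
        / Complex.normSq (structFn L ℓ r θ (x : ℂ)) := by
  have hne : Complex.normSq (structFn L ℓ r θ (x : ℂ)) ≠ 0 :=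
    (Complex.normSq_pos.2 (structFn_ne_zero_real hr0 hr1 L ℓ θ x)).ne'
  rw [Real.cos_two_mul]
  field_simp
  rw [normSq_structFn_real]
  ring

/-! ## The full Poisson profile of the round member -/

/-- `|1 + r e^{iψ}|² = 1 + 2r cos ψ + r²`. [elementary] -/
theorem normSq_one_add_exp (r ψ : ℝ) :
    Complex.normSq (1 + (r : ℂ) * Complex.exp ((ψ : ℂ) * Complex.I)) = 1 + 2 * r * Real.cos ψ + r ^ 2 := by
  rw [Complex.normSq_apply]
  simp only [Complex.add_re, Complex.one_re, Complex.re_ofReal_mul, Complex.exp_ofReal_mul_I_re,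
    Complex.add_im, Complex.one_im, Complex.im_ofReal_mul, Complex.exp_ofReal_mul_I_im, zero_add]
  have h := Real.sin_sq_add_cos_sq ψ
  linear_combination r ^ 2 * h

/-- **The Poisson profile (THEOREM PW1 (c), typed).**  For `0 ≤ r < 1` the round density
`(1 - r²)/|E₀(u)|² = (1 - r²)/(1 + 2r cos ψ + r²)` (`ψ = ℓu + θ`) equals `1 + Σ_{k≥1} 2(-r)^k cos(kψ)`:
beyond the in-band data `1 - 2r cos ψ` (`k ≤ 1`) it carries EVERY harmonic `k ≥ 2` with amplitude
`2 r^k` — in the campaign's regime `ℓ < L < 2ℓ` all of these are out of band. [FAKES §1.15 THEOREM PW1] -/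
theorem poissonProfile_hasSum {r : ℝ} (hr0 : 0 ≤ r) (hr1 : r < 1) (ψ : ℝ) :
    HasSum (fun k : ℕ => 2 * (-r) ^ (k + 1) * Real.cos (((k + 1 : ℕ) : ℝ) * ψ))
      ((1 - r ^ 2) / (1 + 2 * r * Real.cos ψ + r ^ 2) - 1) := by
  set q : ℂ := -(r : ℂ) * Complex.exp ((ψ : ℂ) * Complex.I) with hq
  have hqn : ‖q‖ < 1 := by
    have : ‖q‖ = r := by
      rw [hq, norm_mul, norm_neg, Complex.norm_real, Complex.norm_exp_ofReal_mul_I, mul_one,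
        Real.norm_eq_abs, abs_of_nonneg hr0]
    rw [this]; exact hr1
  have hgeom := hasSum_geometric_of_norm_lt_one hqn
  have h1 : HasSum (fun n : ℕ => q ^ (n + 1)) ((1 - q)⁻¹ - 1) := by
    have := (hasSum_nat_add_iff' 1).2 hgeom
    simpa using this
  have hterm : ∀ n : ℕ, (q ^ (n + 1)).re = (-r) ^ (n + 1) * Real.cos (((n + 1 : ℕ) : ℝ) * ψ) := by
    intro n
    have e : q ^ (n + 1) = (((-r) ^ (n + 1) : ℝ) : ℂ)
        * Complex.exp (((((n + 1 : ℕ) : ℝ) * ψ : ℝ) : ℂ) * Complex.I) := by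
      rw [hq, mul_pow, ← Complex.exp_nat_mul]
      congr 1
      · push_cast; ring
      · congr 1; push_cast; ring
    rw [e, Complex.re_ofReal_mul, Complex.exp_ofReal_mul_I_re]
  have h2 : HasSum (fun n : ℕ => (q ^ (n + 1)).re) (((1 - q)⁻¹ - 1).re) := by
    have := h1.mapL Complex.reCLM
    simpa only [Complex.reCLM_apply] using this
  have h3 := h2.mul_left 2
  have hw : 1 - q = 1 + (r : ℂ) * Complex.exp ((ψ : ℂ) * Complex.I) := by rw [hq]; ring
  have hN : 0 < 1 + 2 * r * Real.cos ψ + r ^ 2 := by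
    have hc : -1 ≤ Real.cos ψ := (abs_le.1 (Real.abs_cos_le_one _)).1
    nlinarith [mul_nonneg hr0 (by linarith : (0:ℝ) ≤ Real.cos ψ + 1)]
  have hval : 2 * ((1 - q)⁻¹ - 1).re = (1 - r ^ 2) / (1 + 2 * r * Real.cos ψ + r ^ 2) - 1 := by
    rw [Complex.sub_re, Complex.one_re, Complex.inv_re, hw, normSq_one_add_exp]
    simp only [Complex.add_re, Complex.one_re, Complex.re_ofReal_mul, Complex.exp_ofReal_mul_I_re]
    field_simp
    ring
  have h4 : HasSum (fun k : ℕ => 2 * (-r) ^ (k + 1) * Real.cos (((k + 1 : ℕ) : ℝ) * ψ))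
      (2 * ((1 - q)⁻¹ - 1).re) := by
    have hf : (fun k : ℕ => 2 * (-r) ^ (k + 1) * Real.cos (((k + 1 : ℕ) : ℝ) * ψ))
        = (fun i : ℕ => 2 * (q ^ (i + 1)).re) := by
      funext n
      rw [hterm]
      ring
    rw [hf]
    exact h3
  rw [← hval]
  exact h4

end Summit.RiemannHypothesis.RiemannHypothesis.Theorems.PfPersistence.Fake1.PWOneFreq
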